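import Mathlib
import Literature.NumberTheory.GaloisRepresentations.SGeneralQuadraticFamily
import Literature.NumberTheory.Automorphic.ReciprocityGLnPatchingGalois

/-!
# Icosahedral quadratic descent — preliminaries, III: the imaginary quadratic fields `ℚ(√-D)`

The auxiliary fields of the descent argument are the members `sqrtNegField ℚ D = ℚ(√-D)`
(`QuadraticAlgebra ℚ (-D) 0`) of the tree's quadratic family (`SGeneralQuadraticFamily`).  Here:
they are totally complex of degree `2`; a prime `p` with `8p ∣ D + 1` splits completely (in
particular `2` splits when `16 ∣ D + 1`, rendered in the shape of the route's hypothesis); primes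
with prescribed congruences exist (Dirichlet).
-/

set_option linter.dupNamespace false

noncomputable section

open scoped NumberField
open NumberField IsDedekindDomain Field
open Literature.NumberTheory.GaloisRepresentations Literature.NumberTheory.GaloisRepresentations.QuadraticFamily

namespace Summit.Langlands.Langlands.Theorems.IcosahedralQuadraticDescent

/-- `-D` is not a square in `ℚ` for `D > 0`. [folklore] -/
theorem not_isSquare_neg_natCast {D : ℕ} (hD : 0 < D) : ¬ IsSquare (-(D : ℚ)) := by
  rintro ⟨r, hr⟩
  have h1 : (0 : ℚ) ≤ r * r := mul_self_nonneg r
  have h2 : (0 : ℚ) < D := by exact_mod_cast hD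
  linarith

/-- The `Fact` making `ℚ(√-D)` a field, for `D > 0`. [folklore] -/
theorem fact_not_isSquare_neg_natCast {D : ℕ} (hD : 0 < D) : Fact (¬ IsSquare (-(D : ℚ))) :=
  ⟨not_isSquare_neg_natCast hD⟩

/-- **`ℚ(√-D)` is totally complex** (`D > 0`): under any complex embedding `ω ↦ s` with
`s² = -D < 0`, so `s` is not real. [folklore] -/
theorem isTotallyComplex_sqrtNegField {D : ℕ} (hD : 0 < D) [Fact (¬ IsSquare (-(D : ℚ)))] :
    IsTotallyComplex (sqrtNegField ℚ D) := by
  refine ⟨fun v => ?_⟩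
  rw [← InfinitePlace.not_isReal_iff_isComplex, ← InfinitePlace.mk_embedding v,
    InfinitePlace.isReal_mk_iff]
  intro hreal
  set φ := InfinitePlace.embedding v with hφ
  have hsq : (φ QuadraticAlgebra.omega) ^ 2 = -(D : ℂ) := by
    rw [← map_pow, omega_sq, map_neg]
    simp
  have hfix : starRingEnd ℂ (φ QuadraticAlgebra.omega) = φ QuadraticAlgebra.omega :=
    RingHom.congr_fun hreal _
  have him : (φ QuadraticAlgebra.omega).im = 0 := Complex.conj_eq_iff_im.mp hfix
  have hre := congrArg Complex.re hsq
  simp only [sq, Complex.mul_re, him, mul_zero, sub_zero, Complex.neg_re, Complex.natCast_re] at hre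
  have h0 : (0 : ℝ) < D := by exact_mod_cast hD
  nlinarith [mul_self_nonneg (φ QuadraticAlgebra.omega).re]

/-- A rational prime lies in some finite place of `ℚ`. [folklore] -/
theorem exists_place_natCast_mem {p : ℕ} (hp : p.Prime) :
    ∃ v : HeightOneSpectrum (𝓞 ℚ), ((p : ℕ) : 𝓞 ℚ) ∈ v.asIdeal := by
  classical
  have hne : Ideal.span {((p : ℕ) : 𝓞 ℚ)} ≠ ⊤ := by
    rw [Ne, Ideal.span_singleton_eq_top]
    intro hu
    have h2 : IsUnit ((p : ℕ) : ℤ) := by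
      have := hu.map Rat.ringOfIntegersEquiv
      rwa [map_natCast] at this
    have h3 := Int.isUnit_iff_natAbs_eq.mp h2
    rw [Int.natAbs_natCast] at h3
    exact hp.one_lt.ne' h3
  obtain ⟨M, hMmax, hle⟩ := Ideal.exists_le_maximal _ hne
  have hM0 : M ≠ ⊥ := by
    intro h0
    rw [h0, le_bot_iff, Ideal.span_singleton_eq_bot] at hle
    exact hp.ne_zero (by exact_mod_cast hle)
  exact ⟨⟨M, hMmax.isPrime, hM0⟩, hle (Ideal.mem_span_singleton_self _)⟩

section Split

variable {D : ℕ} [Fact (¬ IsSquare (-(D : ℚ)))]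

/-- **A prime `p` with `8p ∣ D + 1` splits completely in `ℚ(√-D)`**: the place `v ∋ p` of `ℚ` is
unramified in `ℚ(√-D)`, every place above it has residue degree `1`, and there is such a place.
[folklore] -/
theorem split_of_dvd {p : ℕ} (hp : p.Prime) {v : HeightOneSpectrum (𝓞 ℚ)}
    (hv : ((p : ℕ) : 𝓞 ℚ) ∈ v.asIdeal) (hD : 8 * p ∣ D + 1) :
    Algebra.IsUnramifiedIn (𝓞 (sqrtNegField ℚ D)) v.asIdeal ∧
      (∀ w : HeightOneSpectrum (𝓞 (sqrtNegField ℚ D)), w.asIdeal.under (𝓞 ℚ) = v.asIdeal →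
        w.asIdeal.inertiaDeg (𝓞 ℚ) = 1) ∧
      ∃ w : HeightOneSpectrum (𝓞 (sqrtNegField ℚ D)), w.asIdeal.under (𝓞 ℚ) = v.asIdeal := by
  haveI : Algebra.IsQuadraticExtension ℚ (sqrtNegField ℚ D) := ⟨finrank_sqrtNegField⟩
  haveI : IsGalois ℚ (sqrtNegField ℚ D) := inferInstance
  have h2 : (v.asIdeal.primesOver (𝓞 (sqrtNegField ℚ D))).ncard =
      Module.finrank ℚ (sqrtNegField ℚ D) := by
    rw [finrank_sqrtNegField]
    exact ncard_primesOver_sqrtNegField_eq_two v hp hv hD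
  obtain ⟨he, hf⟩ :=
    Literature.NumberTheory.Automorphic.PatchingFamily.ramificationIdxIn_eq_one_of_ncard_eq_finrank v h2
  refine ⟨?_, fun w hw => ?_, Literature.NumberTheory.Automorphic.exists_above v⟩
  · rw [Algebra.isUnramifiedIn_iff_forall_ramificationIdx_eq_one]
    intro P _ hP
    haveI := hP
    rw [← Ideal.ramificationIdxIn_eq_ramificationIdx v.asIdeal P
      (sqrtNegField ℚ D ≃ₐ[ℚ] sqrtNegField ℚ D)]
    exact he
  · haveI : w.asIdeal.LiesOver v.asIdeal := ⟨hw.symm⟩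
    rw [← Ideal.inertiaDegIn_eq_inertiaDeg v.asIdeal w.asIdeal
      (sqrtNegField ℚ D ≃ₐ[ℚ] sqrtNegField ℚ D)]
    exact hf

/-- **`2` splits in `ℚ(√-D)` when `16 ∣ D + 1`**, in the shape of the route's hypothesis: two
distinct finite places of `ℚ(√-D)` contain `2`. [folklore] -/
theorem exists_two_places_two_mem (hD : 16 ∣ D + 1) :
    ∃ v w : HeightOneSpectrum (𝓞 (sqrtNegField ℚ D)), v ≠ w ∧
      ((2 : ℕ) : 𝓞 (sqrtNegField ℚ D)) ∈ v.asIdeal ∧ ((2 : ℕ) : 𝓞 (sqrtNegField ℚ D)) ∈ w.asIdeal := by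
  classical
  obtain ⟨v₂, hv₂⟩ := exists_place_natCast_mem Nat.prime_two
  have h2 : (v₂.asIdeal.primesOver (𝓞 (sqrtNegField ℚ D))).ncard = 2 :=
    ncard_primesOver_sqrtNegField_eq_two v₂ Nat.prime_two hv₂ (by simpa using hD)
  obtain ⟨P, Q, hPQ, hPQs⟩ := Set.ncard_eq_two.mp h2
  have hP : P ∈ v₂.asIdeal.primesOver (𝓞 (sqrtNegField ℚ D)) := by rw [hPQs]; simp
  have hQ : Q ∈ v₂.asIdeal.primesOver (𝓞 (sqrtNegField ℚ D)) := by rw [hPQs]; simp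
  have hmem : ∀ R ∈ v₂.asIdeal.primesOver (𝓞 (sqrtNegField ℚ D)),
      ((2 : ℕ) : 𝓞 (sqrtNegField ℚ D)) ∈ R := by
    intro R hR
    have h := hR.2.over
    have h' : ((2 : ℕ) : 𝓞 (sqrtNegField ℚ D)) =
        algebraMap (𝓞 ℚ) (𝓞 (sqrtNegField ℚ D)) ((2 : ℕ) : 𝓞 ℚ) :=
      (map_natCast (algebraMap (𝓞 ℚ) (𝓞 (sqrtNegField ℚ D))) 2).symm
    rw [h', ← Ideal.mem_comap]
    change ((2 : ℕ) : 𝓞 ℚ) ∈ R.under (𝓞 ℚ)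
    rw [← h]
    exact hv₂
  refine ⟨⟨P, hP.1, Ideal.ne_bot_of_mem_primesOver v₂.ne_bot hP⟩,
    ⟨Q, hQ.1, Ideal.ne_bot_of_mem_primesOver v₂.ne_bot hQ⟩, ?_, hmem P hP, hmem Q hQ⟩
  intro h
  exact hPQ (congrArg HeightOneSpectrum.asIdeal h)

end Split

/-- **Dirichlet**: there are arbitrarily large primes `D ≡ -1 (mod N)`. [folklore] -/
theorem exists_prime_gt_and_dvd_succ (N : ℕ) (hN : N ≠ 0) (B : ℕ) :
    ∃ D : ℕ, D.Prime ∧ B < D ∧ N ∣ D + 1 := by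
  haveI : NeZero N := ⟨hN⟩
  have hu : IsUnit (-1 : ZMod N) := isUnit_one.neg
  have hinf := Nat.infinite_setOf_prime_and_eq_mod hu
  obtain ⟨D, ⟨hDp, hDmod⟩, hDB⟩ := (hinf.sdiff (Set.finite_Iic B)).nonempty
  refine ⟨D, hDp, not_le.mp hDB, ?_⟩
  rw [← ZMod.natCast_eq_zero_iff]
  push_cast
  rw [hDmod]
  ring

end Summit.Langlands.Langlands.Theorems.IcosahedralQuadraticDescent

end
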